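import Mathlib
import HarnessLib.Audit
import Summits.PneNP.PneNP.Theorems.PstarChordReadOutsideClean

/-!
# THE AFFINE TWO-CHORD THEOREM: two unlinked outside-gated slice-generic chords kill a terminal core (ROUND-24, O1 at exact tightness; memo g21 §15)

FRONTIER range-avoidance ladder, rung F-N3, ROUND 24 (cell `pnp-ideate`, prover-2 memos `g19/O1-CHORD-READ.md` §6.5/§6.10, `g20/O1-CHORD-READ-g20.md`
§13–§14 (residual R1/R2/R3 and the successor TODO "induction over the partner graph"), `g21/O1-CHORD-READ-g21.md` §15; typed target
`PstarCoreBoundTargets.TerminalPeelable` (p646951); restricted-model proof complexity — nothing here bears on `P` versus `NP`).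

* `terminal_sum` — the SUM-READER symmetry: `Terminal (Γ₁, Γ₂) → Terminal (Γ₁, Γ₁ ⊕ Γ₂)`; with `terminal_symm` it makes every gate type `(1,0)`.
* `false_of_two_outsideGated_typeI` — the type-`(1,0)` case assembled from `PstarChordReadOutside.type_eq` (all gates on both chords have the type
  of the designated one), `PstarChordReadOutsideClean.not_mem_lin₂_of_typeI` / `invisible₂_of_typeI` (the second reader is blind to the gated
  privates and to the partners) and `chordLocal₂_of_clean` (free lunch with transport ⟹ `Γ₂` chord-local at both chords ⟹ `Γ₂ ≡ false`,
  `PstarChordReadSwitch.gval_eq_false_of_two_chordLocal` / `false_of_gval₂_const`).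
* **`false_of_two_outsideGated` — THE AFFINE TWO-CHORD THEOREM.**  On a pure typed `(r,3/2)`-expanding instance with simple overlaps, a terminal core
  has no two distinct chords `cᵢ, cⱼ` that are OUTSIDE-GATED (every monomial of `Γ₁, Γ₂` touching the AND pair is a gate `(v, z)`, `v` a private, `z`
  outside the core — automatic at exact tightness), UNLINKED (no common partner; no monomial `(z, z')` coupling a partner of `cᵢ` with one of `cⱼ`)
  and SLICE-GENERIC (`PstarChordReadLemma.SliceGeneric`, the per-chord certificate of kit j314774).  NOTHING is assumed about the other attachments
  of the partners: several gates per private, several `σ`-gates per partner, partners read linearly by either reader, partners coupled to third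
  outside variables or chained through them are all covered — so this one theorem contains `PstarChordReadTwoGates.false_of_two_simpleGates`,
  `PstarChordReadSwitches.false_of_two_switchGated`, `PstarChordReadMenu.false_of_two_generic_simply_read` and
  `PstarChordReadSharedGates.false_of_two_sharedGates` (the last WITHOUT its realisability hypotheses `hvarᵢ/hvarⱼ`), and closes items (1)
  (optional / several `σ`-gates) and, except for a direct coupling of the two chords' own partners (`PstarChordReadCoupledGates`), items (2)–(3) of the
  g20 successor list.  A monomial-free chord needs no partner at all (`PstarChordReadLemma.false_of_monomial_free_chord`).

RESIDUAL at tight `k = 12` after this file (memo g21 §15.4): terminal configurations in which EVERY pair among the `≥ 5` slice-generic chords is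
LINKED — at exact tightness two privates never share a partner, so every pair of generic chords must have a coupling monomial `(zᵢ, zⱼ)` between
some of their partners.  No Assumption A; genericity = `SliceGeneric` at the two chords only.
-/

set_option linter.dupNamespace false -- `Summit.PneNP.PneNP.…`: summit = sub-problem name (D-0017 single-conjunct layout)

open Finset Literature.Computability.Complexity
open scoped symmDiff
open Summit.PneNP.PneNP.Theorems.PstarFibrePolys (bit bit_injective)
open Summit.PneNP.PneNP.Theorems.PstarTyped (Typed)
open Summit.PneNP.PneNP.Theorems.PstarSALevel (varSet bdry BoundaryExpanding SimpleOverlap)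
open Summit.PneNP.PneNP.Theorems.PstarGapPeeling (not_mem_varSet_of_private)
open Summit.PneNP.PneNP.Theorems.PstarCentreFree (vars_mem_varSet)
open Summit.PneNP.PneNP.Theorems.PstarGapOneAll (gval)
open Summit.PneNP.PneNP.Theorems.PstarChordRepair (IsChord)
open Summit.PneNP.PneNP.Theorems.PstarCoreBoundTargets (Terminal)
open Summit.PneNP.PneNP.Theorems.PstarGSystemFreeVar (gval_symmDiff)
open Summit.PneNP.PneNP.Theorems.PstarFreshEraseGates (terminal_symm)
open Summit.PneNP.PneNP.Theorems.PstarChordReadLemma (ChordLocal SliceGeneric false_of_monomial_free_chord)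
open Summit.PneNP.PneNP.Theorems.PstarChordReadSwitch (gval_eq_false_of_two_chordLocal false_of_gval₂_const)
open Summit.PneNP.PneNP.Theorems.PstarChordReadGates (sliceGeneric_mono)
open Summit.PneNP.PneNP.Theorems.PstarChordReadTwoGates (exists_xor_not_mem_of_simpleOverlap)
open Summit.PneNP.PneNP.Theorems.PstarChordReadGates (exists_two_slices)
open Summit.PneNP.PneNP.Theorems.PstarChordReadSwitches (Touches)
open Summit.PneNP.PneNP.Theorems.PstarChordReadFlip
open Summit.PneNP.PneNP.Theorems.PstarChordReadOutside
open Summit.PneNP.PneNP.Theorems.PstarChordReadOutsideClean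

namespace Summit.PneNP.PneNP.Theorems.PstarChordReadOutsideKill

variable {n m : ℕ}

/-! ## The sum-reader symmetry -/
section Sum

variable {I : LocalMap 4 n m} {r : ℕ} {y : Fin m → Bool} {J₀ : Finset (Fin m)} {w₁ w₂ : Finset (Fin n) × Finset (Fin m) × Bool}

/-- **The sum reader.**  `(Γ₁, Γ₂)` terminal ⟹ `(Γ₁, Γ₁ ⊕ Γ₂)` terminal (same core, same solutions, `Γ₁ ∧ Γ₂ ⟺ Γ₁ ∧ (Γ₁ ⊕ Γ₂ = b₁ ⊕ b₂)`). -/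
theorem terminal_sum (ht : Terminal I r y J₀ w₁ w₂) : Terminal I r y J₀ w₁ (w₁.1 ∆ w₂.1, w₁.2.1 ∆ w₂.2.1, xor w₁.2.2 w₂.2.2) := by
  obtain ⟨hne, hX, hJr, hd₁, hd₂, hr, hT3, hM0⟩ := ht
  refine ⟨hne, hX, hJr, hd₁, ?_, ?_, ?_, ?_⟩
  · show Disjoint J₀ (w₁.2.1 ∆ w₂.2.1)
    exact disjoint_left.2 fun j hj hj' => by
      rcases Finset.mem_symmDiff.1 hj' with ⟨h, -⟩ | ⟨h, -⟩
      exacts [disjoint_left.1 hd₁ hj h, disjoint_left.1 hd₂ hj h]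
  · show (J₀ ∪ w₁.2.1 ∪ w₁.2.1 ∆ w₂.2.1).card ≤ r
    refine (card_le_card fun g hg => ?_).trans hr
    simp only [mem_union] at hg ⊢
    rcases hg with (h | h) | h
    · exact Or.inl (Or.inl h)
    · exact Or.inl (Or.inr h)
    · rcases Finset.mem_symmDiff.1 h with ⟨h, -⟩ | ⟨h, -⟩
      exacts [Or.inl (Or.inr h), Or.inr h]
  · show ¬ ∃ z : Fin n → Bool, (∀ j ∈ J₀, I.eval z j = y j) ∧ gval I w₁.1 w₁.2.1 z = w₁.2.2 ∧
      gval I (w₁.1 ∆ w₂.1) (w₁.2.1 ∆ w₂.2.1) z = xor w₁.2.2 w₂.2.2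
    rintro ⟨z, hz, h₁, h₂⟩
    rw [gval_symmDiff, h₁] at h₂
    refine hT3 ⟨z, hz, h₁, ?_⟩
    revert h₂; cases gval I w₂.1 w₂.2.1 z <;> cases w₁.2.2 <;> cases w₂.2.2 <;> decide
  · show ∀ f ∈ J₀, ∃ z : Fin n → Bool, (∀ j ∈ J₀.erase f, I.eval z j = y j) ∧ gval I w₁.1 w₁.2.1 z = w₁.2.2 ∧
      gval I (w₁.1 ∆ w₂.1) (w₁.2.1 ∆ w₂.2.1) z = xor w₁.2.2 w₂.2.2
    intro f hf
    obtain ⟨z, hz, h₁, h₂⟩ := hM0 f hf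
    exact ⟨z, hz, h₁, by rw [gval_symmDiff, h₁, h₂]⟩

/-- `G₁ ∪ (G₁ ∆ G₂) = G₁ ∪ G₂`: the sum pair has the same monomial set. -/
theorem union_symmDiff_eq (G₁ G₂ : Finset (Fin m)) : G₁ ∪ G₁ ∆ G₂ = G₁ ∪ G₂ := by
  ext g
  rw [mem_union, mem_union, Finset.mem_symmDiff]
  tauto

end Sum

/-! ## Small helpers -/
section Helpers

variable {I : LocalMap 4 n m} {J₀ : Finset (Fin m)} {𝒢 : Finset (Fin m)} {cᵢ cⱼ : Fin m}

/-- The co-private of a private. -/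
theorem exists_copriv {c : Fin m} {v : Fin n} (hv : v = I.vars c 2 ∨ v = I.vars c 3) :
    ∃ v' : Fin n, (I.vars c 2 = v ∧ I.vars c 3 = v') ∨ (I.vars c 2 = v' ∧ I.vars c 3 = v) := by
  rcases hv with e | e
  · exact ⟨I.vars c 3, Or.inl ⟨e.symm, rfl⟩⟩
  · exact ⟨I.vars c 2, Or.inr ⟨rfl, e.symm⟩⟩

/-- On the slice `(0,0)` the co-private is `0`. -/
theorem copriv_false {c : Fin m} {v v' : Fin n} (hvv : (I.vars c 2 = v ∧ I.vars c 3 = v') ∨ (I.vars c 2 = v' ∧ I.vars c 3 = v))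
    {x : Fin n → Bool} (h2 : x (I.vars c 2) = false) (h3 : x (I.vars c 3) = false) : x v' = false := by
  rcases hvv with ⟨-, h⟩ | ⟨h, -⟩
  · rw [← h]; exact h3
  · rw [← h]; exact h2

/-- `Unlinked` is symmetric. -/
theorem unlinked_symm (h : Unlinked I J₀ 𝒢 cᵢ cⱼ) : Unlinked I J₀ 𝒢 cⱼ cᵢ :=
  fun z z' hz hz' => ⟨(h z' z hz' hz).1.symm, fun g hg H => (h z' z hz' hz).2 g hg H.symm⟩

/-- A monomial that does not touch `c` avoids its AND pair. -/
theorem avoids_of_not_touches {c g : Fin m} (h : ¬ Touches I c g) :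
    (I.vars g 2 ≠ I.vars c 2 ∧ I.vars g 3 ≠ I.vars c 2) ∧ (I.vars g 2 ≠ I.vars c 3 ∧ I.vars g 3 ≠ I.vars c 3) := by
  unfold PstarChordReadSwitches.Touches at h
  push Not at h
  exact h

end Helpers

/-! ## The theorem -/
section Main

variable {I : LocalMap 4 n m} {r : ℕ} {y : Fin m → Bool} {J₀ : Finset (Fin m)} {w₁ w₂ : Finset (Fin n) × Finset (Fin m) × Bool}
  {cᵢ cⱼ : Fin m}

/-- **The type-`(1,0)` case.**  Two distinct outside-gated unlinked slice-generic chords, `cᵢ` carrying a gate `gᵢ ∈ G₁ ∖ G₂` and `cⱼ` carrying some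
monomial: contradiction. -/
theorem false_of_two_outsideGated_typeI (hI : I.IsPure xorAndPred) (hT : Typed I) (hS : SimpleOverlap I) (hB : BoundaryExpanding r I)
    (ht : Terminal I r y J₀ w₁ w₂) (hcᵢ : cᵢ ∈ J₀) (hcⱼ : cⱼ ∈ J₀) (hne : cᵢ ≠ cⱼ) (hchᵢ : IsChord I J₀ cᵢ) (hchⱼ : IsChord I J₀ cⱼ)
    (hOᵢ : OutsideGated I J₀ (w₁.2.1 ∪ w₂.2.1) cᵢ) (hOⱼ : OutsideGated I J₀ (w₁.2.1 ∪ w₂.2.1) cⱼ)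
    (hU : Unlinked I J₀ (w₁.2.1 ∪ w₂.2.1) cᵢ cⱼ)
    (hgenᵢ : SliceGeneric I y J₀ cᵢ (w₁.2.1 ∪ w₂.2.1)) (hgenⱼ : SliceGeneric I y J₀ cⱼ (w₁.2.1 ∪ w₂.2.1))
    {gᵢ : Fin m} {vᵢ zᵢ : Fin n} (hgᵢ : gᵢ ∈ w₁.2.1 ∪ w₂.2.1) (hGᵢ : IsGate I J₀ cᵢ gᵢ vᵢ zᵢ) (hgᵢ₁ : gᵢ ∈ w₁.2.1) (hgᵢ₂ : gᵢ ∉ w₂.2.1)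
    (hexⱼ : ∃ g ∈ w₁.2.1 ∪ w₂.2.1, Touches I cⱼ g) : False := by
  classical
  have hv := exists_xor_not_mem_of_simpleOverlap hI hS hne
  -- the gate on `cⱼ`, co-privates, partners
  obtain ⟨gⱼ, hgⱼ, htⱼ⟩ := hexⱼ
  obtain ⟨vⱼ, zⱼ, hGⱼ⟩ := hOⱼ gⱼ hgⱼ htⱼ
  obtain ⟨vᵢ', hvᵢ⟩ := exists_copriv hGᵢ.1
  obtain ⟨vⱼ', hvⱼ⟩ := exists_copriv hGⱼ.1
  have hPᵢ : Partner I J₀ (w₁.2.1 ∪ w₂.2.1) cᵢ zᵢ := ⟨gᵢ, hgᵢ, vᵢ, hGᵢ⟩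
  have hPⱼ : Partner I J₀ (w₁.2.1 ∪ w₂.2.1) cⱼ zⱼ := ⟨gⱼ, hgⱼ, vⱼ, hGⱼ⟩
  have hU' := unlinked_symm hU
  -- one solution with all four privates `0`
  obtain ⟨x, hx, hx2ᵢ, hx3ᵢ, hx2ⱼ, hx3ⱼ⟩ := exists_two_slices hI hcᵢ hcⱼ hne hchᵢ hchⱼ hv hgenᵢ false false false false
  -- any outside gate on `cᵢ` and any outside gate on `cⱼ` have the same type
  have TYPES : ∀ {g g' : Fin m} {v z v' z' : Fin n}, g ∈ w₁.2.1 ∪ w₂.2.1 → IsGate I J₀ cᵢ g v z → g' ∈ w₁.2.1 ∪ w₂.2.1 →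
      IsGate I J₀ cⱼ g' v' z' → decide (g ∈ w₁.2.1) = decide (g' ∈ w₁.2.1) ∧ decide (g ∈ w₂.2.1) = decide (g' ∈ w₂.2.1) := by
    intro g g' v z v' z' hg hG hg' hG'
    obtain ⟨u, hu⟩ := exists_copriv hG.1
    obtain ⟨u', hu'⟩ := exists_copriv hG'.1
    have hP : Partner I J₀ (w₁.2.1 ∪ w₂.2.1) cᵢ z := ⟨g, hg, v, hG⟩
    have hP' : Partner I J₀ (w₁.2.1 ∪ w₂.2.1) cⱼ z' := ⟨g', hg', v', hG'⟩
    obtain ⟨hzz, hnozz⟩ := hU z z' hP hP'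
    have hno₁ := no_pair_priv hU hOⱼ hcⱼ hP hG'.1
    have hno₂ := no_pair_priv hU' hOᵢ hcᵢ hP' hG.1
    exact type_eq hI hS ht hcᵢ hcⱼ hne hchᵢ hchⱼ hu hu' hg hG.2.1 hG.2.2 hg' hG'.2.1 hG'.2.2 hzz (fun h hh H => hnozz h hh H.symm)
      (fun h hh H => hno₁ h hh H.symm) (fun h hh H => hno₂ h hh H.symm) hx (copriv_false hu hx2ᵢ hx3ᵢ) (copriv_false hu' hx2ⱼ hx3ⱼ)
  -- so `gⱼ` has type `(1,0)` …
  obtain ⟨e₁, e₂⟩ := TYPES hgᵢ hGᵢ hgⱼ hGⱼ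
  rw [decide_eq_true hgᵢ₁] at e₁
  rw [decide_eq_false hgᵢ₂] at e₂
  have hgⱼ₁ : gⱼ ∈ w₁.2.1 := of_decide_eq_true e₁.symm
  have hgⱼ₂ : gⱼ ∉ w₂.2.1 := of_decide_eq_false e₂.symm
  -- … and no monomial of `G₂` touches either AND pair
  have hmonoᵢ : ∀ h ∈ w₂.2.1,
      (I.vars h 2 ≠ I.vars cᵢ 2 ∧ I.vars h 3 ≠ I.vars cᵢ 2) ∧ (I.vars h 2 ≠ I.vars cᵢ 3 ∧ I.vars h 3 ≠ I.vars cᵢ 3) := by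
    intro h hh
    by_contra H
    obtain ⟨v, z, hG⟩ := hOᵢ h (mem_union_right _ hh) H
    obtain ⟨-, e⟩ := TYPES (mem_union_right _ hh) hG hgⱼ hGⱼ
    rw [decide_eq_true hh, decide_eq_false hgⱼ₂] at e
    exact absurd e (by decide)
  have hmonoⱼ : ∀ h ∈ w₂.2.1,
      (I.vars h 2 ≠ I.vars cⱼ 2 ∧ I.vars h 3 ≠ I.vars cⱼ 2) ∧ (I.vars h 2 ≠ I.vars cⱼ 3 ∧ I.vars h 3 ≠ I.vars cⱼ 3) := by
    intro h hh
    by_contra H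
    obtain ⟨v, z, hG⟩ := hOⱼ h (mem_union_right _ hh) H
    obtain ⟨-, e⟩ := TYPES hgᵢ hGᵢ (mem_union_right _ hh) hG
    rw [decide_eq_true hh, decide_eq_false hgᵢ₂] at e
    exact absurd e (by decide)
  have hG₂vᵢ : ∀ g ∈ w₂.2.1, I.vars g 2 ≠ vᵢ ∧ I.vars g 3 ≠ vᵢ := by
    intro g hg
    rcases hGᵢ.1 with e | e <;> rw [e]
    exacts [(hmonoᵢ g hg).1, (hmonoᵢ g hg).2]
  have hG₂vⱼ : ∀ g ∈ w₂.2.1, I.vars g 2 ≠ vⱼ ∧ I.vars g 3 ≠ vⱼ := by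
    intro g hg
    rcases hGⱼ.1 with e | e <;> rw [e]
    exacts [(hmonoⱼ g hg).1, (hmonoⱼ g hg).2]
  -- link facts for the designated pair
  obtain ⟨hzz, hnozz⟩ := hU zᵢ zⱼ hPᵢ hPⱼ
  have hnoᵢ := no_pair_priv hU hOⱼ hcⱼ hPᵢ hGⱼ.1
  have hnoⱼ := no_pair_priv hU' hOᵢ hcᵢ hPⱼ hGᵢ.1
  have h0ᵢ := copriv_false hvᵢ hx2ᵢ hx3ᵢ
  have h0ⱼ := copriv_false hvⱼ hx2ⱼ hx3ⱼ
  -- the gated privates are not read by `Γ₂`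
  have hvᵢC : vᵢ ∉ w₂.1 :=
    not_mem_lin₂_of_typeI hI hS ht hcᵢ hcⱼ hne hchᵢ hchⱼ hvᵢ hvⱼ hgᵢ₁ hgᵢ₂ hGᵢ.2.1 hGᵢ.2.2 hgⱼ₁ hGⱼ.2.1 hGⱼ.2.2 hzz
      (fun h hh H => hnozz h hh H.symm) (fun h hh H => hnoⱼ h hh H.symm) hG₂vᵢ hx h0ᵢ h0ⱼ
  have hvⱼC : vⱼ ∉ w₂.1 :=
    not_mem_lin₂_of_typeI hI hS ht hcⱼ hcᵢ hne.symm hchⱼ hchᵢ hvⱼ hvᵢ hgⱼ₁ hgⱼ₂ hGⱼ.2.1 hGⱼ.2.2 hgᵢ₁ hGᵢ.2.1 hGᵢ.2.2 hzz.symm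
      hnozz (fun h hh H => hnoᵢ h hh H.symm) hG₂vⱼ hx h0ⱼ h0ᵢ
  -- the partners are invisible to `Γ₂`
  have hinvᵢ := invisible₂_of_typeI hI hT hS ht hcⱼ hchⱼ hvⱼ hgⱼ₁ hgⱼ₂ hGⱼ.2.1 hGⱼ.2.2 hGᵢ.2.2 hzz.symm hnozz
    (fun h hh H => no_pair_priv hU hOⱼ hcⱼ hPᵢ (Or.inl rfl) h hh H.symm)
    (fun h hh H => no_pair_priv hU hOⱼ hcⱼ hPᵢ (Or.inr rfl) h hh H.symm) hgenⱼ hx h0ⱼ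
  have hinvⱼ := invisible₂_of_typeI hI hT hS ht hcᵢ hchᵢ hvᵢ hgᵢ₁ hgᵢ₂ hGᵢ.2.1 hGᵢ.2.2 hGⱼ.2.2 hzz
    (fun h hh H => hnozz h hh H.symm)
    (fun h hh H => no_pair_priv hU' hOᵢ hcᵢ hPⱼ (Or.inl rfl) h hh H.symm)
    (fun h hh H => no_pair_priv hU' hOᵢ hcᵢ hPⱼ (Or.inr rfl) h hh H.symm) hgenᵢ hx h0ᵢ
  -- `Γ₂` is chord-local at both chords, hence constant
  have hlocᵢ : ChordLocal I cᵢ w₂.1 w₂.2.1 :=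
    chordLocal₂_of_clean hI hS ht hcᵢ hchᵢ hvᵢ hgᵢ₁ hGᵢ.2.1 hGᵢ.2.2 hinvᵢ.1 hinvᵢ.2 hvᵢC hmonoᵢ subset_union_right hgenᵢ
  have hlocⱼ : ChordLocal I cⱼ w₂.1 w₂.2.1 :=
    chordLocal₂_of_clean hI hS ht hcⱼ hchⱼ hvⱼ hgⱼ₁ hGⱼ.2.1 hGⱼ.2.2 hinvⱼ.1 hinvⱼ.2 hvⱼC hmonoⱼ subset_union_right hgenⱼ
  refine false_of_gval₂_const hI hT hS hB ht fun x x' => ?_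
  rw [gval_eq_false_of_two_chordLocal hI hcᵢ hcⱼ hne hchᵢ hv hlocᵢ hlocⱼ x,
    gval_eq_false_of_two_chordLocal hI hcᵢ hcⱼ hne hchᵢ hv hlocᵢ hlocⱼ x']

/-- **THE AFFINE TWO-CHORD THEOREM.**  On a pure typed `(r,3/2)`-expanding instance with simple overlaps, a terminal core has no two distinct
OUTSIDE-GATED, UNLINKED, SLICE-GENERIC chords. -/
theorem false_of_two_outsideGated (hI : I.IsPure xorAndPred) (hT : Typed I) (hS : SimpleOverlap I) (hB : BoundaryExpanding r I)
    (ht : Terminal I r y J₀ w₁ w₂) (hcᵢ : cᵢ ∈ J₀) (hcⱼ : cⱼ ∈ J₀) (hne : cᵢ ≠ cⱼ) (hchᵢ : IsChord I J₀ cᵢ) (hchⱼ : IsChord I J₀ cⱼ)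
    (hOᵢ : OutsideGated I J₀ (w₁.2.1 ∪ w₂.2.1) cᵢ) (hOⱼ : OutsideGated I J₀ (w₁.2.1 ∪ w₂.2.1) cⱼ)
    (hU : Unlinked I J₀ (w₁.2.1 ∪ w₂.2.1) cᵢ cⱼ)
    (hgenᵢ : SliceGeneric I y J₀ cᵢ (w₁.2.1 ∪ w₂.2.1)) (hgenⱼ : SliceGeneric I y J₀ cⱼ (w₁.2.1 ∪ w₂.2.1)) : False := by
  classical
  -- monomial-free chords die alone
  by_cases hexᵢ : ∃ g ∈ w₁.2.1 ∪ w₂.2.1, Touches I cᵢ g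
  swap
  · push Not at hexᵢ
    exact false_of_monomial_free_chord I hI hT hS hB ht hcᵢ hchᵢ (fun g hg => avoids_of_not_touches (hexᵢ g hg)) hgenᵢ
  by_cases hexⱼ : ∃ g ∈ w₁.2.1 ∪ w₂.2.1, Touches I cⱼ g
  swap
  · push Not at hexⱼ
    exact false_of_monomial_free_chord I hI hT hS hB ht hcⱼ hchⱼ (fun g hg => avoids_of_not_touches (hexⱼ g hg)) hgenⱼ
  obtain ⟨gᵢ, hgᵢ, htᵢ⟩ := hexᵢ
  obtain ⟨vᵢ, zᵢ, hGᵢ⟩ := hOᵢ gᵢ hgᵢ htᵢ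
  by_cases h₁ : gᵢ ∈ w₁.2.1 <;> by_cases h₂ : gᵢ ∈ w₂.2.1
  · -- type `(1,1)`: pass to the sum reader
    have hGG := union_symmDiff_eq w₁.2.1 w₂.2.1
    obtain ⟨gⱼ, hgⱼ, htⱼ⟩ := hexⱼ
    refine false_of_two_outsideGated_typeI (w₂ := (w₁.1 ∆ w₂.1, w₁.2.1 ∆ w₂.2.1, xor w₁.2.2 w₂.2.2)) hI hT hS hB (terminal_sum ht)
      hcᵢ hcⱼ hne hchᵢ hchⱼ ?_ ?_ ?_ ?_ ?_ (gᵢ := gᵢ) ?_ hGᵢ h₁ ?_ ?_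
    · show OutsideGated I J₀ (w₁.2.1 ∪ w₁.2.1 ∆ w₂.2.1) cᵢ; rw [hGG]; exact hOᵢ
    · show OutsideGated I J₀ (w₁.2.1 ∪ w₁.2.1 ∆ w₂.2.1) cⱼ; rw [hGG]; exact hOⱼ
    · show Unlinked I J₀ (w₁.2.1 ∪ w₁.2.1 ∆ w₂.2.1) cᵢ cⱼ; rw [hGG]; exact hU
    · show SliceGeneric I y J₀ cᵢ (w₁.2.1 ∪ w₁.2.1 ∆ w₂.2.1); rw [hGG]; exact hgenᵢ
    · show SliceGeneric I y J₀ cⱼ (w₁.2.1 ∪ w₁.2.1 ∆ w₂.2.1); rw [hGG]; exact hgenⱼ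
    · show gᵢ ∈ w₁.2.1 ∪ w₁.2.1 ∆ w₂.2.1; rw [hGG]; exact hgᵢ
    · show gᵢ ∉ w₁.2.1 ∆ w₂.2.1
      rw [Finset.mem_symmDiff]; push Not; exact ⟨fun _ => h₂, fun _ => h₁⟩
    · exact ⟨gⱼ, by show gⱼ ∈ w₁.2.1 ∪ w₁.2.1 ∆ w₂.2.1; rw [hGG]; exact hgⱼ, htⱼ⟩
  · -- type `(1,0)`
    exact false_of_two_outsideGated_typeI hI hT hS hB ht hcᵢ hcⱼ hne hchᵢ hchⱼ hOᵢ hOⱼ hU hgenᵢ hgenⱼ hgᵢ hGᵢ h₁ h₂ hexⱼ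
  · -- type `(0,1)`: exchange the readers
    rw [union_comm] at hOᵢ hOⱼ hU hgenᵢ hgenⱼ hgᵢ hexⱼ
    exact false_of_two_outsideGated_typeI hI hT hS hB (terminal_symm ht) hcᵢ hcⱼ hne hchᵢ hchⱼ hOᵢ hOⱼ hU hgenᵢ hgenⱼ hgᵢ hGᵢ h₂ h₁ hexⱼ
  · exact absurd hgᵢ (by rw [mem_union, not_or]; exact ⟨h₁, h₂⟩)

end Main

end Summit.PneNP.PneNP.Theorems.PstarChordReadOutsideKill
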